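import Summits.CriticalPhenomena.PercolationContinuityZ3.Theorems.PercNearOneGluingNoHeavyLowerTailSunflowerMultiPetalModule
import Summits.CriticalPhenomena.PercolationContinuityZ3.Theorems.PercNearOneGluingNoHeavyLowerTailSunflowerMultiPetalHomeRouting
import HarnessLib
import HarnessLib.Audit

/-!
# `NoHeavyLowerTail` (crux stmt-CriticalPhenomena-4575), abstract sunflower cubic, `k` petals: the FLIPPED MODULE IDENTITY — Theorem C for one module and
# every flip set: `ZKflip D = Σ_P N_D(P) · C_D(P)`, the flipped partition functional of a blow-up as a nonnegative combination of flipped lifted sums of its quotient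

Support file (seat `prim-l12-p2` gen 33; `--supports stmt-CriticalPhenomena-4575`; companion of `…SunflowerMultiPetalModule` (p358966: `IsModule`, `gsum`, `glue`, the
unflipped identity `gsum_eq_sum_pattern`, the trace decomposition `sum_partsOf_eq_sum_traces` / `sum_partsOf_trace_eq`) and `…SunflowerMultiPetalHomeRouting` (p359567:
`MSunflower.ZKflip`, Conjecture G = `FlipPartitionLemmaK`)).  Everything here is PROVED; no `sorry`, no named fact.
Memo: run/shared/lean/prim/prim-l12/prim-l12-p2/FINDING-g33-MODULE-LIFT.md §1.6 / §6.

* `MSunflower.gsumFlip W D G₀ G₁ G₂ := Σ_{(r₀,r₁,r₂) ⊢ W} s6K (lab (r₀ ∆ D ∪ G₀)) (lab (r₁ ∆ D ∪ G₁)) (lab (r₂ ∆ D ∪ G₂))` — glued sums with the blocks FLIPPED along `D`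
  (`gsumFlip_empty : gsumFlip W ∅ = gsum W`, `ZKflip_eq_gsumFlip : ZKflip D = gsumFlip univ D ∅ ∅ ∅`).
* Set algebra of a trace: for `R` disjoint from `M` and `S ⊆ M`, `(R ∪ S) ∆ D = (R ∆ (D ∖ M)) ∪ (S ∆ (D ∩ M))` (`union_symmDiff_split`).
* **`gsumFlip_eq_sum_pattern`** (this work): for a module `(M, g)` with `M ⊆ W` and glue sets disjoint from `M`,
    `gsumFlip W D G₀ G₁ G₂ = Σ_{P ⊆ Fin 3} N_D(P) · gsumFlip (W ∖ M) (D ∖ M) (G₀ ∪ [0∈P]M) (G₁ ∪ [1∈P]M) (G₂ ∪ [2∈P]M)`,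
  `N_D(P) = #{traces s on M whose FLIPPED firing pattern (g fires on s_j ∆ (D ∩ M)) is P}` — the flip inside the module only changes the gadget statistics, the flip
  outside rides along.  Whole type: **`ZKflip_eq_sum_pattern`**, and **`ZKflip_nonneg_of_isModule`**: the coefficient `Z_D` of Conjecture G for the blow-up is
  nonnegative as soon as the eight flipped lifted sums of the quotient are — THEOREM C of FINDING-g30 §5 for one module and EVERY flip set (iterate over disjoint modules
  for compositions; the unflipped `D = ∅` case is p358966's `ZK_nonneg_of_isModule`).
-/

namespace Summit.CriticalPhenomena.PercolationContinuityZ3.Theorems.SunflowerPartition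

open Finset

variable {α : Type*} [DecidableEq α]

/-! ## Set algebra of flipped traces -/

omit [DecidableEq α] in
/-- For `R` disjoint from `M` and `S ⊆ M`: `(R ∪ S) ∆ D = (R ∆ (D ∖ M)) ∪ (S ∆ (D ∩ M))`. [this work] -/
theorem union_symmDiff_split [DecidableEq α] {R S M D : Finset α} (hR : Disjoint R M) (hS : S ⊆ M) :
    symmDiff (R ∪ S) D = symmDiff R (D \ M) ∪ symmDiff S (D ∩ M) := by
  ext x
  have h1 : x ∈ R → x ∉ M := fun h hM => Finset.disjoint_left.1 hR h hM
  have h2 : x ∈ S → x ∈ M := fun h => hS h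
  simp only [mem_symmDiff, mem_union, mem_sdiff, mem_inter]
  tauto

omit [DecidableEq α] in
/-- A flip along `D ∖ M` keeps a set disjoint from `M` disjoint from `M`. [this work] -/
theorem disjoint_symmDiff_sdiff [DecidableEq α] {R M D : Finset α} (hR : Disjoint R M) : Disjoint (symmDiff R (D \ M)) M := by
  rw [Finset.disjoint_left]
  intro x hx hxM
  rw [mem_symmDiff] at hx
  rcases hx with ⟨hxR, -⟩ | ⟨hxD, -⟩
  · exact Finset.disjoint_left.1 hR hxR hxM
  · exact (mem_sdiff.1 hxD).2 hxM

omit [DecidableEq α] in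
/-- A flip along `D ∩ M` keeps a subset of `M` inside `M`. [this work] -/
theorem symmDiff_inter_subset [DecidableEq α] {S M D : Finset α} (hS : S ⊆ M) : symmDiff S (D ∩ M) ⊆ M := by
  intro x hx
  rw [mem_symmDiff] at hx
  rcases hx with ⟨hxS, -⟩ | ⟨hxD, -⟩
  · exact hS hxS
  · exact (mem_inter.1 hxD).2

namespace MSunflower

variable {k : ℕ} (F : MSunflower k α)

/-! ## Flipped glued sums -/

/-- FLIPPED glued partition sum over a window `W`: every block is replaced by its symmetric difference with `D` before the glue sets are added. [this work] -/
def gsumFlip (W D G₀ G₁ G₂ : Finset α) : ℤ :=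
  ∑ r ∈ partsOf W, s6K k (F.lab (symmDiff r.1 D ∪ G₀)) (F.lab (symmDiff r.2 D ∪ G₁)) (F.lab (symmDiff (W \ (r.1 ∪ r.2)) D ∪ G₂))

/-- Without flips the flipped glued sum is the glued sum. [this work] -/
theorem gsumFlip_empty (W G₀ G₁ G₂ : Finset α) : F.gsumFlip W ∅ G₀ G₁ G₂ = F.gsum W G₀ G₁ G₂ := by
  unfold gsumFlip gsum
  have h : ∀ s : Finset α, symmDiff s ∅ = s := fun s => symmDiff_bot s
  simp only [h]

/-- `ZKflip D` is the unglued flipped sum over the whole ground set. [this work] -/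
theorem ZKflip_eq_gsumFlip [Fintype α] (D : Finset α) : F.ZKflip D = F.gsumFlip univ D ∅ ∅ ∅ := by
  unfold ZKflip gsumFlip
  rw [partsOf_univ]
  refine sum_congr rfl fun q _ => ?_
  rw [union_empty, union_empty, union_empty, compl_eq_univ_sdiff]

/-- The FLIPPED firing pattern of the gadget `g` on a trace `s` of `M`, the trace blocks being flipped along `Din ⊆ M`. [this work] -/
def patF (M : Finset α) (g : Finset α → Bool) (Din : Finset α) (s : Finset α × Finset α) : Finset (Fin 3) :=
  (univ : Finset (Fin 3)).filter fun j =>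
    (j = 0 ∧ g (symmDiff s.1 Din) = true) ∨ (j = 1 ∧ g (symmDiff s.2 Din) = true) ∨ (j = 2 ∧ g (symmDiff (M \ (s.1 ∪ s.2)) Din) = true)

variable {F}

/-- Under the module property, the label of a flipped block `(r ∪ s) ∆ D ∪ G` (`r, G` disjoint from `M`, `s ⊆ M`) is the label of `r ∆ (D ∖ M) ∪ G` with `M` glued iff
`g` fires on the flipped trace `s ∆ (D ∩ M)`. [this work] -/
theorem lab_union_trace_flip {M : Finset α} {g : Finset α → Bool} (hF : F.IsModule M g) {r s G : Finset α} (D : Finset α)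
    (hr : Disjoint r M) (hs : s ⊆ M) (hG : Disjoint G M) :
    F.lab (symmDiff (r ∪ s) D ∪ G) = F.lab (symmDiff r (D \ M) ∪ G ∪ (if g (symmDiff s (D ∩ M)) then M else ∅)) := by
  rw [union_symmDiff_split hr hs]
  exact F.lab_union_trace hF (disjoint_symmDiff_sdiff hr) (symmDiff_inter_subset hs) hG

variable (F)

/-- **The flipped module identity**: the module `M ⊆ W` is replaced by one glued point sitting in the blocks `P`, weighted by the FLIPPED gadget statistics
`N_D(P) = #{s ∈ partsOf M : patF M g (D ∩ M) s = P}`; outside the module the flip set becomes `D ∖ M`. [this work] -/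
theorem gsumFlip_eq_sum_pattern {M : Finset α} {g : Finset α → Bool} (hF : F.IsModule M g) {W D G₀ G₁ G₂ : Finset α}
    (hMW : M ⊆ W) (h0 : Disjoint G₀ M) (h1 : Disjoint G₁ M) (h2 : Disjoint G₂ M) :
    F.gsumFlip W D G₀ G₁ G₂ = ∑ P : Finset (Fin 3), (((partsOf M).filter fun s => patF M g (D ∩ M) s = P).card : ℤ) *
      F.gsumFlip (W \ M) (D \ M) (G₀ ∪ glue M P 0) (G₁ ∪ glue M P 1) (G₂ ∪ glue M P 2) := by
  unfold gsumFlip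
  rw [sum_partsOf_eq_sum_traces W M (fun q => s6K k (F.lab (symmDiff q.1 D ∪ G₀)) (F.lab (symmDiff q.2 D ∪ G₁)) (F.lab (symmDiff (W \ (q.1 ∪ q.2)) D ∪ G₂)))]
  have inner : ∀ s ∈ partsOf M,
      ∑ q ∈ (partsOf W).filter (fun q => q.1 ∩ M = s.1 ∧ q.2 ∩ M = s.2),
          s6K k (F.lab (symmDiff q.1 D ∪ G₀)) (F.lab (symmDiff q.2 D ∪ G₁)) (F.lab (symmDiff (W \ (q.1 ∪ q.2)) D ∪ G₂))
        = ∑ r ∈ partsOf (W \ M), s6K k (F.lab (symmDiff r.1 (D \ M) ∪ (G₀ ∪ glue M (patF M g (D ∩ M) s) 0)))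
            (F.lab (symmDiff r.2 (D \ M) ∪ (G₁ ∪ glue M (patF M g (D ∩ M) s) 1)))
            (F.lab (symmDiff ((W \ M) \ (r.1 ∪ r.2)) (D \ M) ∪ (G₂ ∪ glue M (patF M g (D ∩ M) s) 2))) := by
    intro s hs
    rw [sum_partsOf_trace_eq W M hMW hs (fun X Y Z => s6K k (F.lab (symmDiff X D ∪ G₀)) (F.lab (symmDiff Y D ∪ G₁)) (F.lab (symmDiff Z D ∪ G₂)))]
    obtain ⟨hs1, hs2, -⟩ := (Sunflower.mem_partsOf_iff).1 hs
    have hs3 : M \ (s.1 ∪ s.2) ⊆ M := sdiff_subset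
    refine sum_congr rfl fun r hr => ?_
    obtain ⟨hr1, hr2, -⟩ := (Sunflower.mem_partsOf_iff).1 hr
    have hr3 : (W \ M) \ (r.1 ∪ r.2) ⊆ W \ M := sdiff_subset
    have p0 : ((0 : Fin 3) ∈ patF M g (D ∩ M) s) = (g (symmDiff s.1 (D ∩ M)) = true) := by unfold patF; simp
    have p1 : ((1 : Fin 3) ∈ patF M g (D ∩ M) s) = (g (symmDiff s.2 (D ∩ M)) = true) := by unfold patF; simp
    have p2 : ((2 : Fin 3) ∈ patF M g (D ∩ M) s) = (g (symmDiff (M \ (s.1 ∪ s.2)) (D ∩ M)) = true) := by unfold patF; simp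
    rw [lab_union_trace_flip hF D (disjoint_of_subset_sdiff' hr1) hs1 h0, lab_union_trace_flip hF D (disjoint_of_subset_sdiff' hr2) hs2 h1,
      lab_union_trace_flip hF D (disjoint_of_subset_sdiff' hr3) hs3 h2]
    unfold glue
    simp only [p0, p1, p2, union_assoc]
  rw [sum_congr rfl inner]
  rw [← sum_fiberwise_of_maps_to (s := partsOf M) (t := (univ : Finset (Finset (Fin 3)))) (g := fun s => patF M g (D ∩ M) s)
    (fun s _ => mem_univ _)]
  refine sum_congr rfl fun P _ => ?_
  rw [sum_congr rfl (fun s hs => by rw [(mem_filter.1 hs).2] :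
    ∀ s ∈ (partsOf M).filter (fun s => patF M g (D ∩ M) s = P),
      (∑ r ∈ partsOf (W \ M), s6K k (F.lab (symmDiff r.1 (D \ M) ∪ (G₀ ∪ glue M (patF M g (D ∩ M) s) 0)))
          (F.lab (symmDiff r.2 (D \ M) ∪ (G₁ ∪ glue M (patF M g (D ∩ M) s) 1)))
          (F.lab (symmDiff ((W \ M) \ (r.1 ∪ r.2)) (D \ M) ∪ (G₂ ∪ glue M (patF M g (D ∩ M) s) 2))))
        = ∑ r ∈ partsOf (W \ M), s6K k (F.lab (symmDiff r.1 (D \ M) ∪ (G₀ ∪ glue M P 0)))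
            (F.lab (symmDiff r.2 (D \ M) ∪ (G₁ ∪ glue M P 1)))
            (F.lab (symmDiff ((W \ M) \ (r.1 ∪ r.2)) (D \ M) ∪ (G₂ ∪ glue M P 2))))]
  rw [sum_const, nsmul_eq_mul]

/-- The eight FLIPPED lifted sums of the quotient by the module `M` (flip set `D ∖ M` outside, module point placed in the blocks `P`). [this work] -/
def modCoefFlip [Fintype α] (M D : Finset α) (P : Finset (Fin 3)) : ℤ := F.gsumFlip Mᶜ (D \ M) (glue M P 0) (glue M P 1) (glue M P 2)

/-- **`ZKflip D = Σ_P N_D(P) · C_D(P)`** for a module `(M, g)` and every flip set `D`. [this work] -/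
theorem ZKflip_eq_sum_pattern [Fintype α] {M : Finset α} {g : Finset α → Bool} (hF : F.IsModule M g) (D : Finset α) :
    F.ZKflip D = ∑ P : Finset (Fin 3), (((partsOf M).filter fun s => patF M g (D ∩ M) s = P).card : ℤ) * F.modCoefFlip M D P := by
  rw [F.ZKflip_eq_gsumFlip, F.gsumFlip_eq_sum_pattern hF (subset_univ M) (disjoint_empty_left M) (disjoint_empty_left M) (disjoint_empty_left M)]
  unfold modCoefFlip
  refine sum_congr rfl fun P _ => ?_
  rw [empty_union, empty_union, empty_union, compl_eq_univ_sdiff]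

/-- **THEOREM C for one module, every flip set**: if `(M, g)` is a module of `F` and the eight flipped lifted sums `C_D(P)` of its quotient are nonnegative, then the
coefficient `Z_D` of Conjecture G for `F` is nonnegative: `0 ≤ ZKflip D`. [this work] -/
theorem ZKflip_nonneg_of_isModule [Fintype α] {M : Finset α} {g : Finset α → Bool} (hF : F.IsModule M g) (D : Finset α)
    (hC : ∀ P : Finset (Fin 3), 0 ≤ F.modCoefFlip M D P) : 0 ≤ F.ZKflip D := by
  rw [F.ZKflip_eq_sum_pattern hF D]
  exact sum_nonneg fun P _ => mul_nonneg (by exact_mod_cast Nat.zero_le _) (hC P)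

/-- **Iterable form**: if for a module `M ⊆ W` every flipped glued sum over `W ∖ M` with the module glued in the blocks `P` is nonnegative, so is the flipped glued sum
over `W`. [this work] -/
theorem gsumFlip_nonneg_of_isModule {M : Finset α} {g : Finset α → Bool} (hF : F.IsModule M g) {W D G₀ G₁ G₂ : Finset α}
    (hMW : M ⊆ W) (h0 : Disjoint G₀ M) (h1 : Disjoint G₁ M) (h2 : Disjoint G₂ M)
    (hC : ∀ P : Finset (Fin 3), 0 ≤ F.gsumFlip (W \ M) (D \ M) (G₀ ∪ glue M P 0) (G₁ ∪ glue M P 1) (G₂ ∪ glue M P 2)) :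
    0 ≤ F.gsumFlip W D G₀ G₁ G₂ := by
  rw [F.gsumFlip_eq_sum_pattern hF hMW h0 h1 h2]
  exact sum_nonneg fun P _ => mul_nonneg (by exact_mod_cast Nat.zero_le _) (hC P)

/-- Over the empty window the flipped glued sum is the single kernel value of the flipped empty blocks `D ∪ G_j`. [this work] -/
theorem gsumFlip_window_empty (D G₀ G₁ G₂ : Finset α) :
    F.gsumFlip ∅ D G₀ G₁ G₂ = s6K k (F.lab (D ∪ G₀)) (F.lab (D ∪ G₁)) (F.lab (D ∪ G₂)) := by
  unfold gsumFlip
  rw [partsOf_empty, sum_singleton]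
  have h : symmDiff (∅ : Finset α) D = D := by rw [symmDiff_comm]; exact symmDiff_bot D
  simp only [empty_union, sdiff_empty, h]

end MSunflower

end Summit.CriticalPhenomena.PercolationContinuityZ3.Theorems.SunflowerPartition
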